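import Summits.Ventures.PercRepro.Night2ShapeOneSigma

/-!
# PercRepro — the seven-point shape (i): PER-SIDE bounds of the column bound, part D (night-2, gen 30)

ONE SIDE = one line with its three sources and three `K`-faces (the face of `ℓ₁` at `p` has closure `K_p` and is shared by
the two sources `≠ p`).  The outside points VISIBLE on the side are those off at least one of its three closures; a visible
point in `H` is free (in no `K_p`) or attached to one `p`, a visible point off `H` likewise and it is GOOD for every source
of the side (Night2ShapeOneSigma, proofs/NIGHT-2-g30.md §3).  With the counts `fE` (free, in `H`), `a_p` (attached, in `H`),
`zf` (free, off `H`), `z_p` (attached, off `H`): `s_p = fE + zf + (a_c + z_c) + (a_d + z_d)` visible points off `K_p`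
(`m(K_p) = 2 + s_p`) and `g_p = 1 + fE + a_p + zf + (z₁ + z₂ + z₃)` good points of the source `p`.  The CORE lemmas take the
three losses `L_q` abstractly with their three properties (`lossHF_props`): nonnegative, `≤ sigHF s_c + sigHF s_d`, and
vanishing when a face of the source is null.  This part: **B14** (no visible `Z`-point and `N ≥ 3`: `≤ 13/80`).
-/

namespace PercRepro.Shadow

section Side

variable {fE a₁ a₂ a₃ zf z₁ z₂ z₃ s₁ s₂ s₃ g₁ g₂ g₃ : ℕ} {L₁ L₂ L₃ : ℚ}

set_option maxHeartbeats 1600000 in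
/-- **B14 (core).** No visible `Z`-point and at least three visible points: the load is at most `117/720 = 13/80`. -/
theorem sideHF_core_nozeta_N3
    (hs₁ : s₁ = fE + zf + (a₂ + z₂) + (a₃ + z₃)) (hs₂ : s₂ = fE + zf + (a₁ + z₁) + (a₃ + z₃))
    (hs₃ : s₃ = fE + zf + (a₁ + z₁) + (a₂ + z₂))
    (hg₁ : g₁ = 1 + fE + a₁ + zf + (z₁ + z₂ + z₃)) (hg₂ : g₂ = 1 + fE + a₂ + zf + (z₁ + z₂ + z₃))
    (hg₃ : g₃ = 1 + fE + a₃ + zf + (z₁ + z₂ + z₃))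
    (hL₁ : 0 ≤ L₁) (hB₁ : L₁ ≤ sigHF s₂ + sigHF s₃) (hn₁ : s₂ = 0 ∨ s₃ = 0 → L₁ = 0)
    (hL₂ : 0 ≤ L₂) (hB₂ : L₂ ≤ sigHF s₁ + sigHF s₃) (hn₂ : s₁ = 0 ∨ s₃ = 0 → L₂ = 0)
    (hL₃ : 0 ≤ L₃) (hB₃ : L₃ ≤ sigHF s₁ + sigHF s₂) (hn₃ : s₁ = 0 ∨ s₂ = 0 → L₃ = 0)
    (hζ : zf + (z₁ + z₂ + z₃) = 0) (hN : 3 ≤ fE + zf + (a₁ + z₁) + (a₂ + z₂) + (a₃ + z₃)) :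
    L₁ / (g₁ : ℚ) + L₂ / (g₂ : ℚ) + L₃ / (g₃ : ℚ) ≤ 13 / 80 := by
  have hσ₁ := sigHF_nonneg s₁
  have hσ₂ := sigHF_nonneg s₂
  have hσ₃ := sigHF_nonneg s₃
  have hσ₁' := sigHF_le_one s₁
  have hσ₂' := sigHF_le_one s₂
  have hσ₃' := sigHF_le_one s₃
  have hzf : zf = 0 := by omega
  have hz₁ : z₁ = 0 := by omega
  have hz₂ : z₂ = 0 := by omega
  have hz₃ : z₃ = 0 := by omega
  have key : ∀ (tp tc td : ℚ) (bp bc bd : ℚ), tp ≤ bp → tc ≤ bc → td ≤ bd → bp + bc + bd ≤ 13 / 80 →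
      tp + tc + td ≤ 13 / 80 := by intros; linarith
  rcases Nat.lt_or_ge fE 2 with hf | hf
  swap
  · have e₁ := sigHF_le_two (s := s₁) (by omega)
    have e₂ := sigHF_le_two (s := s₂) (by omega)
    have e₃ := sigHF_le_two (s := s₃) (by omega)
    have t₁ := div_nat_le_div_of_le hL₁ (hB₁.trans (by linarith : sigHF s₂ + sigHF s₃ ≤ 50 / 720)) (g := g₁) (k := 3) (by norm_num) (by omega)
    have t₂ := div_nat_le_div_of_le hL₂ (hB₂.trans (by linarith : sigHF s₁ + sigHF s₃ ≤ 50 / 720)) (g := g₂) (k := 3) (by norm_num) (by omega)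
    have t₃ := div_nat_le_div_of_le hL₃ (hB₃.trans (by linarith : sigHF s₁ + sigHF s₂ ≤ 50 / 720)) (g := g₃) (k := 3) (by norm_num) (by omega)
    exact key _ _ _ _ _ _ t₁ t₂ t₃ (by norm_num)
  rcases Nat.lt_or_ge fE 1 with hf0 | hf1
  swap
  · -- `fE = 1`, `Σ a ≥ 2`
    by_cases hbig : 2 ≤ a₁ ∨ 2 ≤ a₂ ∨ 2 ≤ a₃
    · rcases hbig with h | h | h
      · have f₂ := sigHF_le_three (s := s₂) (by omega)
        have f₃ := sigHF_le_three (s := s₃) (by omega)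
        have t₁ := div_nat_le_div_of_le hL₁ (hB₁.trans (by linarith : sigHF s₂ + sigHF s₃ ≤ 10 / 720)) (g := g₁) (k := 4) (by norm_num) (by omega)
        have t₂ := div_nat_le_div_of_le hL₂ (hB₂.trans (by linarith : sigHF s₁ + sigHF s₃ ≤ 58 / 720)) (g := g₂) (k := 2) (by norm_num) (by omega)
        have t₃ := div_nat_le_div_of_le hL₃ (hB₃.trans (by linarith : sigHF s₁ + sigHF s₂ ≤ 58 / 720)) (g := g₃) (k := 2) (by norm_num) (by omega)
        exact key _ _ _ _ _ _ t₁ t₂ t₃ (by norm_num)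
      · have f₁ := sigHF_le_three (s := s₁) (by omega)
        have f₃ := sigHF_le_three (s := s₃) (by omega)
        have t₂ := div_nat_le_div_of_le hL₂ (hB₂.trans (by linarith : sigHF s₁ + sigHF s₃ ≤ 10 / 720)) (g := g₂) (k := 4) (by norm_num) (by omega)
        have t₁ := div_nat_le_div_of_le hL₁ (hB₁.trans (by linarith : sigHF s₂ + sigHF s₃ ≤ 58 / 720)) (g := g₁) (k := 2) (by norm_num) (by omega)
        have t₃ := div_nat_le_div_of_le hL₃ (hB₃.trans (by linarith : sigHF s₁ + sigHF s₂ ≤ 58 / 720)) (g := g₃) (k := 2) (by norm_num) (by omega)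
        exact key _ _ _ _ _ _ t₁ t₂ t₃ (by norm_num)
      · have f₁ := sigHF_le_three (s := s₁) (by omega)
        have f₂ := sigHF_le_three (s := s₂) (by omega)
        have t₃ := div_nat_le_div_of_le hL₃ (hB₃.trans (by linarith : sigHF s₁ + sigHF s₂ ≤ 10 / 720)) (g := g₃) (k := 4) (by norm_num) (by omega)
        have t₁ := div_nat_le_div_of_le hL₁ (hB₁.trans (by linarith : sigHF s₂ + sigHF s₃ ≤ 58 / 720)) (g := g₁) (k := 2) (by norm_num) (by omega)
        have t₂ := div_nat_le_div_of_le hL₂ (hB₂.trans (by linarith : sigHF s₁ + sigHF s₃ ≤ 58 / 720)) (g := g₂) (k := 2) (by norm_num) (by omega)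
        exact key _ _ _ _ _ _ t₁ t₂ t₃ (by norm_num)
    · push Not at hbig
      by_cases h12 : a₁ = 1 ∧ a₂ = 1
      · have f₃ := sigHF_le_three (s := s₃) (by omega)
        have e₁ := sigHF_le_two (s := s₁) (by omega)
        have e₂ := sigHF_le_two (s := s₂) (by omega)
        have t₃ := div_nat_le_div_of_le hL₃ (hB₃.trans (by linarith : sigHF s₁ + sigHF s₂ ≤ 50 / 720)) (g := g₃) (k := 2) (by norm_num) (by omega)
        have t₁ := div_nat_le_div_of_le hL₁ (hB₁.trans (by linarith : sigHF s₂ + sigHF s₃ ≤ 30 / 720)) (g := g₁) (k := 3) (by norm_num) (by omega)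
        have t₂ := div_nat_le_div_of_le hL₂ (hB₂.trans (by linarith : sigHF s₁ + sigHF s₃ ≤ 30 / 720)) (g := g₂) (k := 3) (by norm_num) (by omega)
        exact key _ _ _ _ _ _ t₁ t₂ t₃ (by norm_num)
      · by_cases h13 : a₁ = 1 ∧ a₃ = 1
        · have f₂ := sigHF_le_three (s := s₂) (by omega)
          have e₁ := sigHF_le_two (s := s₁) (by omega)
          have e₃ := sigHF_le_two (s := s₃) (by omega)
          have t₂ := div_nat_le_div_of_le hL₂ (hB₂.trans (by linarith : sigHF s₁ + sigHF s₃ ≤ 50 / 720)) (g := g₂) (k := 2) (by norm_num) (by omega)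
          have t₁ := div_nat_le_div_of_le hL₁ (hB₁.trans (by linarith : sigHF s₂ + sigHF s₃ ≤ 30 / 720)) (g := g₁) (k := 3) (by norm_num) (by omega)
          have t₃ := div_nat_le_div_of_le hL₃ (hB₃.trans (by linarith : sigHF s₁ + sigHF s₂ ≤ 30 / 720)) (g := g₃) (k := 3) (by norm_num) (by omega)
          exact key _ _ _ _ _ _ t₁ t₂ t₃ (by norm_num)
        · have h23 : a₂ = 1 ∧ a₃ = 1 := by omega
          have f₁ := sigHF_le_three (s := s₁) (by omega)
          have e₂ := sigHF_le_two (s := s₂) (by omega)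
          have e₃ := sigHF_le_two (s := s₃) (by omega)
          have t₁ := div_nat_le_div_of_le hL₁ (hB₁.trans (by linarith : sigHF s₂ + sigHF s₃ ≤ 50 / 720)) (g := g₁) (k := 2) (by norm_num) (by omega)
          have t₂ := div_nat_le_div_of_le hL₂ (hB₂.trans (by linarith : sigHF s₁ + sigHF s₃ ≤ 30 / 720)) (g := g₂) (k := 3) (by norm_num) (by omega)
          have t₃ := div_nat_le_div_of_le hL₃ (hB₃.trans (by linarith : sigHF s₁ + sigHF s₂ ≤ 30 / 720)) (g := g₃) (k := 3) (by norm_num) (by omega)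
          exact key _ _ _ _ _ _ t₁ t₂ t₃ (by norm_num)
  · -- `fE = 0`
    have hfE : fE = 0 := by omega
    by_cases hnull : s₁ = 0 ∨ s₂ = 0 ∨ s₃ = 0
    · rcases hnull with h | h | h
      · rw [hn₂ (Or.inl h), hn₃ (Or.inl h), zero_div_nat, zero_div_nat]
        have f₂ := sigHF_le_three (s := s₂) (by omega)
        have f₃ := sigHF_le_three (s := s₃) (by omega)
        have t₁ := div_nat_le_div_of_le hL₁ (hB₁.trans (by linarith : sigHF s₂ + sigHF s₃ ≤ 10 / 720)) (g := g₁) (k := 4) (by norm_num) (by omega)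
        norm_num at t₁; linarith
      · rw [hn₁ (Or.inl h), hn₃ (Or.inr h), zero_div_nat, zero_div_nat]
        have f₁ := sigHF_le_three (s := s₁) (by omega)
        have f₃ := sigHF_le_three (s := s₃) (by omega)
        have t₂ := div_nat_le_div_of_le hL₂ (hB₂.trans (by linarith : sigHF s₁ + sigHF s₃ ≤ 10 / 720)) (g := g₂) (k := 4) (by norm_num) (by omega)
        norm_num at t₂; linarith
      · rw [hn₁ (Or.inr h), hn₂ (Or.inr h), zero_div_nat, zero_div_nat]
        have f₁ := sigHF_le_three (s := s₁) (by omega)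
        have f₂ := sigHF_le_three (s := s₂) (by omega)
        have t₃ := div_nat_le_div_of_le hL₃ (hB₃.trans (by linarith : sigHF s₁ + sigHF s₂ ≤ 10 / 720)) (g := g₃) (k := 4) (by norm_num) (by omega)
        norm_num at t₃; linarith
    · push Not at hnull
      have one0 : ∀ (tp tc td : ℚ) (nc nd : ℕ), 1 ≤ nc → 1 ≤ nd → 3 ≤ nc + nd →
          tp ≤ sigHF nc + sigHF nd → tc ≤ (5 / 720 + sigHF nc) / ((1 + nc : ℕ) : ℚ) →
          td ≤ (5 / 720 + sigHF nd) / ((1 + nd : ℕ) : ℚ) → tp + tc + td ≤ 13 / 80 := by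
        intro tp tc td nc nd hc hd h3 htp htc htd
        have := omegaHF_sum_le nc nd hc hd h3
        linarith
      rcases Nat.eq_zero_or_pos a₁ with h1 | h1
      · have f₁ := sigHF_le_three (s := s₁) (by omega)
        have hs₂' : s₂ = a₃ := by omega
        have hs₃' : s₃ = a₂ := by omega
        have t₁ := div_nat_le_div_of_le hL₁ hB₁ (g := g₁) (k := 1) (by norm_num) (by omega)
        have t₂ := div_nat_le_div_of_le hL₂ (hB₂.trans (by linarith : sigHF s₁ + sigHF s₃ ≤ 5 / 720 + sigHF s₃)) (g := g₂) (k := 1 + a₂) (by omega) (by omega)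
        have t₃ := div_nat_le_div_of_le hL₃ (hB₃.trans (by linarith : sigHF s₁ + sigHF s₂ ≤ 5 / 720 + sigHF s₂)) (g := g₃) (k := 1 + a₃) (by omega) (by omega)
        rw [hs₂', hs₃'] at t₁; rw [hs₃'] at t₂; rw [hs₂'] at t₃
        norm_num at t₁
        have h := one0 (L₁ / (g₁ : ℚ)) _ _ a₂ a₃ (by omega) (by omega) (by omega) (by linarith) t₂ t₃
        linarith
      · rcases Nat.eq_zero_or_pos a₂ with h2 | h2
        · have f₂ := sigHF_le_three (s := s₂) (by omega)
          have hs₁' : s₁ = a₃ := by omega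
          have hs₃' : s₃ = a₁ := by omega
          have t₂ := div_nat_le_div_of_le hL₂ hB₂ (g := g₂) (k := 1) (by norm_num) (by omega)
          have t₁ := div_nat_le_div_of_le hL₁ (hB₁.trans (by linarith : sigHF s₂ + sigHF s₃ ≤ 5 / 720 + sigHF s₃)) (g := g₁) (k := 1 + a₁) (by omega) (by omega)
          have t₃ := div_nat_le_div_of_le hL₃ (hB₃.trans (by linarith : sigHF s₁ + sigHF s₂ ≤ 5 / 720 + sigHF s₁)) (g := g₃) (k := 1 + a₃) (by omega) (by omega)
          rw [hs₁', hs₃'] at t₂; rw [hs₃'] at t₁; rw [hs₁'] at t₃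
          norm_num at t₂
          have h := one0 (L₂ / (g₂ : ℚ)) _ _ a₁ a₃ (by omega) (by omega) (by omega) (by linarith) t₁ t₃
          linarith
        · rcases Nat.eq_zero_or_pos a₃ with h3 | h3
          · have f₃ := sigHF_le_three (s := s₃) (by omega)
            have hs₁' : s₁ = a₂ := by omega
            have hs₂' : s₂ = a₁ := by omega
            have t₃ := div_nat_le_div_of_le hL₃ hB₃ (g := g₃) (k := 1) (by norm_num) (by omega)
            have t₁ := div_nat_le_div_of_le hL₁ (hB₁.trans (by linarith : sigHF s₂ + sigHF s₃ ≤ 5 / 720 + sigHF s₂)) (g := g₁) (k := 1 + a₁) (by omega) (by omega)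
            have t₂ := div_nat_le_div_of_le hL₂ (hB₂.trans (by linarith : sigHF s₁ + sigHF s₃ ≤ 5 / 720 + sigHF s₁)) (g := g₂) (k := 1 + a₂) (by omega) (by omega)
            rw [hs₁', hs₂'] at t₃; rw [hs₂'] at t₁; rw [hs₁'] at t₂
            norm_num at t₃
            have h := one0 (L₃ / (g₃ : ℚ)) _ _ a₁ a₂ (by omega) (by omega) (by omega) (by linarith) t₁ t₂
            linarith
          · by_cases hbig : 2 ≤ a₁ ∨ 2 ≤ a₂ ∨ 2 ≤ a₃
            · rcases hbig with h | h | h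
              · have f₂ := sigHF_le_three (s := s₂) (by omega)
                have f₃ := sigHF_le_three (s := s₃) (by omega)
                have e₁ := sigHF_le_two (s := s₁) (by omega)
                have t₁ := div_nat_le_div_of_le hL₁ (hB₁.trans (by linarith : sigHF s₂ + sigHF s₃ ≤ 10 / 720)) (g := g₁) (k := 3) (by norm_num) (by omega)
                have t₂ := div_nat_le_div_of_le hL₂ (hB₂.trans (by linarith : sigHF s₁ + sigHF s₃ ≤ 30 / 720)) (g := g₂) (k := 2) (by norm_num) (by omega)
                have t₃ := div_nat_le_div_of_le hL₃ (hB₃.trans (by linarith : sigHF s₁ + sigHF s₂ ≤ 30 / 720)) (g := g₃) (k := 2) (by norm_num) (by omega)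
                exact key _ _ _ _ _ _ t₁ t₂ t₃ (by norm_num)
              · have f₁ := sigHF_le_three (s := s₁) (by omega)
                have f₃ := sigHF_le_three (s := s₃) (by omega)
                have e₂ := sigHF_le_two (s := s₂) (by omega)
                have t₂ := div_nat_le_div_of_le hL₂ (hB₂.trans (by linarith : sigHF s₁ + sigHF s₃ ≤ 10 / 720)) (g := g₂) (k := 3) (by norm_num) (by omega)
                have t₁ := div_nat_le_div_of_le hL₁ (hB₁.trans (by linarith : sigHF s₂ + sigHF s₃ ≤ 30 / 720)) (g := g₁) (k := 2) (by norm_num) (by omega)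
                have t₃ := div_nat_le_div_of_le hL₃ (hB₃.trans (by linarith : sigHF s₁ + sigHF s₂ ≤ 30 / 720)) (g := g₃) (k := 2) (by norm_num) (by omega)
                exact key _ _ _ _ _ _ t₁ t₂ t₃ (by norm_num)
              · have f₁ := sigHF_le_three (s := s₁) (by omega)
                have f₂ := sigHF_le_three (s := s₂) (by omega)
                have e₃ := sigHF_le_two (s := s₃) (by omega)
                have t₃ := div_nat_le_div_of_le hL₃ (hB₃.trans (by linarith : sigHF s₁ + sigHF s₂ ≤ 10 / 720)) (g := g₃) (k := 3) (by norm_num) (by omega)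
                have t₁ := div_nat_le_div_of_le hL₁ (hB₁.trans (by linarith : sigHF s₂ + sigHF s₃ ≤ 30 / 720)) (g := g₁) (k := 2) (by norm_num) (by omega)
                have t₂ := div_nat_le_div_of_le hL₂ (hB₂.trans (by linarith : sigHF s₁ + sigHF s₃ ≤ 30 / 720)) (g := g₂) (k := 2) (by norm_num) (by omega)
                exact key _ _ _ _ _ _ t₁ t₂ t₃ (by norm_num)
            · -- all `a = 1`: every `s = 2`, every `g = 2`
              push Not at hbig
              have e₁ := sigHF_le_two (s := s₁) (by omega)
              have e₂ := sigHF_le_two (s := s₂) (by omega)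
              have e₃ := sigHF_le_two (s := s₃) (by omega)
              have t₁ := div_nat_le_div_of_le hL₁ (hB₁.trans (by linarith : sigHF s₂ + sigHF s₃ ≤ 50 / 720)) (g := g₁) (k := 2) (by norm_num) (by omega)
              have t₂ := div_nat_le_div_of_le hL₂ (hB₂.trans (by linarith : sigHF s₁ + sigHF s₃ ≤ 50 / 720)) (g := g₂) (k := 2) (by norm_num) (by omega)
              have t₃ := div_nat_le_div_of_le hL₃ (hB₃.trans (by linarith : sigHF s₁ + sigHF s₂ ≤ 50 / 720)) (g := g₃) (k := 2) (by norm_num) (by omega)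
              exact key _ _ _ _ _ _ t₁ t₂ t₃ (by norm_num)
end Side

end PercRepro.Shadow
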